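import Summits.MatrixMultiplication.OmegaCensus.STPPVosperSlackFourLawT
import Summits.MatrixMultiplication.OmegaCensus.STPPVosperSlackFourRows61F5A0Asm
import Summits.MatrixMultiplication.OmegaCensus.STPPVosperSlackFourRows61F5A1Asm
import Summits.MatrixMultiplication.OmegaCensus.STPPVosperSlackFourRows61F5TblA0Asm
import Summits.MatrixMultiplication.OmegaCensus.STPPVosperSlackFourRows61F5TblA1Asm
import Summits.MatrixMultiplication.OmegaCensus.STPPVosperSlackFourCell22Reduce
import Summits.MatrixMultiplication.OmegaCensus.STPPVosperSlackFourCell22RowsAsm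
import Summits.MatrixMultiplication.OmegaCensus.STPPVosperSlackFourCell22TblRowsAsm
import Summits.MatrixMultiplication.OmegaCensus.STPPVosperTilingWordsPrunedQ
import Summits.MatrixMultiplication.OmegaCensus.STPPHamidouneRodsethInverseTheorem
import Summits.MatrixMultiplication.OmegaCensus.STPPZoo313NodesG10

/-!
# ω-census (abelian STPP census): `{(2,2,2),(3,3,3),(3,3,3)} ⊄ ℤ₆₁` modulo the zoo's root row — the LAST ℤ₆₁ leaf (slack 4)

HONEST FRAMING (pub-omega census; verbatim): lottery ticket; floor = certified bounds/negative ranges.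
Census STRUCTURE (seat pub-omega-stpp-2 gen 28, 2026-08-29), family (b2).  The fifth and last open leaf of the ℤ₆₁ HR-kernel axis: block `1` read
`(3,3,3)`, others `(2,2,2)`, `(3,3,3)` (`z = L = 13`, `vol = 27`, `13 + 3 + 27 + 3 + 13 + 2 = 61`: N18-slack 4).  stpp-1 g33's slack-4 law
`no_isSTPP_of_slack_four_tables_of_cell22` (`STPPVosperSlackFourLawT.lean`) with stpp-2 g27's Vosper / Hamidoune–Rødseth rows and dead tables
(`rows61F5A0_choose`, `rows61F5A1`, `dead61TblA0`, `dead61TblA1` — the same rows serve the role-swapped cells since `a = b`, `z = L`) and its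
structure-free cell (2,2) discharged by `c22_false_of_rows` (`STPPVosperSlackFourCell22Reduce.lean`: the cell-(2,2) kernel rows `c22_rows61`, the dead table
`dead22_coverDead`, and the (3,13)@61 two-above zoo).  `no_isSTPP_zmod61_222_333_333_of_zooRow`: the kill GIVEN the zoo checker's root row
`zooGo 61 zooTbl61 12 59 3 0 1 [0] = true`; `no_isSTPP_zmod61_222_333_333`: UNCONDITIONAL, the root row being `zooNd_rroot` (`STPPZoo313NodesG10.lean`:
node glue over stpp-1 g33's 425 zoo rows `STPPZoo313Rows1–93.lean`).  Axioms standard.  With the four earlier ℤ₆₁ kills this closes the ℤ₆₁ HR-kernel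
axis («54/54»).  Nothing here is progress on `ω`.

References: H. Cohn, R. Kleinberg, B. Szegedy, C. Umans, FOCS 2005 (arXiv:math/0511460), Def. 5.1; A. G. Vosper, J. London Math. Soc. 31 (1956);
Y. O. Hamidoune, Ø. J. Rødseth, Acta Arith. 92 (2000).
-/

open Finset
open scoped Pointwise

namespace Summit.MatrixMultiplication.OmegaCensus.CubeNB

open Literature.Computability.AlgebraicComplexity
open Literature.Combinatorics.Additive
open Summit.MatrixMultiplication.OmegaCensus.STPPKneser
open Summit.MatrixMultiplication.OmegaCensus.CubeNB.S2

/-- **`{(2,2,2),(3,3,3),(3,3,3)} ⊄ ℤ₆₁` given the zoo's root row.**  No simultaneous-triple-product family of `ℤ/61` has size pattern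
`(|A₀|,|B₀|,|C₀|) = (2,2,2)`, `(|A₁|,|B₁|,|C₁|) = (|A₂|,|B₂|,|C₂|) = (3,3,3)` — provided the root row of the (3,13)@61 zoo checker holds.
[cite: CohnKleinbergSzegedyUmans2005, Def. 5.1] [cite: Vosper1956, main theorem; Nathanson1996, Thm 2.7] [cite: HamidouneRodseth2000, main theorem (§1, p. 252)] -/
theorem no_isSTPP_zmod61_222_333_333_of_zooRow (hzr : zooGo 61 zooTbl61 12 59 3 0 1 [0] = true)
    (A B C : Fin 3 → Finset (ZMod 61)) (hS : IsSTPP A B C)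
    (hA : ∀ i, #(A i) = ![2, 3, 3] i) (hB : ∀ i, #(B i) = ![2, 3, 3] i) (hC : ∀ i, #(C i) = ![2, 3, 3] i) : False := by
  haveI : Fact (Nat.Prime 61) := ⟨by norm_num⟩
  have hAne : ∀ i, (A i).Nonempty := fun i => card_pos.1 (by rw [hA]; fin_cases i <;> simp)
  have hBne : ∀ i, (B i).Nonempty := fun i => card_pos.1 (by rw [hB]; fin_cases i <;> simp)
  have hCne : ∀ i, (C i).Nonempty := fun i => card_pos.1 (by rw [hC]; fin_cases i <;> simp)
  have e1 : (univ : Finset (Fin 3)).erase 1 = {0, 2} := by decide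
  have hz : ∑ k ∈ (univ : Finset (Fin 3)).erase 1, #(A k) * #(C k) = 13 := by
    rw [e1, Finset.sum_pair (by decide)]; simp [hA, hC]
  have hL : ∑ k ∈ (univ : Finset (Fin 3)).erase 1, #(B k) * #(C k) = 13 := by
    rw [e1, Finset.sum_pair (by decide)]; simp [hB, hC]
  have hszsA : ([2, 0] : List (Fin 3)).map (fun k => (#(A k), #(B k), #(C k))) = [(3, 3, 3), (2, 2, 2)] := by simp [hA, hB, hC]
  have hszsB : ([2, 0] : List (Fin 3)).map (fun k => (#(B k), #(A k), #(C k))) = [(3, 3, 3), (2, 2, 2)] := by simp [hA, hB, hC]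
  have hdead0 : ∀ e ∈ tblZ61F5A0, CoverDead 61 3 1 [(3, 3, 3), (2, 2, 2)] e.1 e.2 :=
    coverDead_forall_of_rows (blockEnumSound_blockDiffsWQ 61) fun e he => dead61TblA0 e he
  have hdead1 : ∀ e ∈ tblZ61F5A1, CoverDead 61 3 1 [(3, 3, 3), (2, 2, 2)] e.1 e.2 :=
    coverDead_forall_of_rows (blockEnumSound_blockDiffsWQ 61) fun e he => dead61TblA1 e he
  have hdead22 : ∀ e ∈ tbl22, CoverDead 61 3 1 [(3, 3, 3), (2, 2, 2)] e.1 e.2 := dead22_coverDead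
  exact no_isSTPP_of_slack_four_tables_of_cell22 hamidouneRodsethInverseTheorem_holds hS hAne hBne hCne 1 ⟨0, by decide⟩
    (a := 3) (b := 3) (c := 3) (L := 13) (z := 13) (vol := 27) (tblA0 := tblZ61F5A0) (tblB0 := tblZ61F5A0) (tblA1 := tblZ61F5A1)
    (tblB1 := tblZ61F5A1) (by rw [hA]; rfl) (by rw [hB]; rfl) (by rw [hC]; rfl) hz hL rfl (by norm_num) (by norm_num) (by norm_num) (by norm_num)
    (by norm_num) (by norm_num) (by norm_num) [2, 0] (by decide) (fun k => by fin_cases k <;> decide) hszsA hszsB hdead0 hdead0 hdead1 hdead1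
    rows61F5A0_choose rows61F5A0_choose rows61F5A1 rows61F5A1
    (fun h17 h17' => c22_false_of_rows hzr c22_rows61 hS hAne hBne hCne 1 (by rw [hA]; rfl) (by rw [hB]; rfl) (by rw [hC]; rfl) hz hL
      [2, 0] (by decide) (fun k => by fin_cases k <;> decide) hszsA hdead22 h17 h17')

/-- **`{(2,2,2),(3,3,3),(3,3,3)} ⊄ ℤ₆₁` (kernel, UNCONDITIONAL).**  No simultaneous-triple-product family of `ℤ/61` has size pattern
`(|A₀|,|B₀|,|C₀|) = (2,2,2)`, `(|A₁|,|B₁|,|C₁|) = (|A₂|,|B₂|,|C₂|) = (3,3,3)`.  The last ℤ₆₁ leaf: stpp-1 g33's slack-4 law and (3,13)@61 zoo, stpp-2 g27's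
Vosper / Hamidoune–Rødseth rows, stpp-2 g28's structure-free cell (2,2). [cite: CohnKleinbergSzegedyUmans2005, Def. 5.1]
[cite: Vosper1956, main theorem; Nathanson1996, Thm 2.7] [cite: HamidouneRodseth2000, main theorem (§1, p. 252)] -/
theorem no_isSTPP_zmod61_222_333_333 (A B C : Fin 3 → Finset (ZMod 61)) (hS : IsSTPP A B C)
    (hA : ∀ i, #(A i) = ![2, 3, 3] i) (hB : ∀ i, #(B i) = ![2, 3, 3] i) (hC : ∀ i, #(C i) = ![2, 3, 3] i) : False :=
  no_isSTPP_zmod61_222_333_333_of_zooRow zooNd_rroot A B C hS hA hB hC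

end Summit.MatrixMultiplication.OmegaCensus.CubeNB
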